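import Literature.NumberTheory.LFunctions.ZetaArgSIntegralLowHeightNumerics
import Literature.NumberTheory.LFunctions.ZetaArgSLemma2Unconditional
import HarnessLib

/-!
# RH-FREE — Brent–Platt–Trudgian 2021: the printed error terms of Theorem 1 (1.3), Lemma 3, BAMS Lemma 2 / Theorem 2 and Example 1 from `T₀ = 2π` on, with NO hypothesis («nothing here bears on the truth of RH»)

Topic `Literature/NumberTheory/LFunctions` (RH literature-typing tranche 1, L4 "explicit zero
statistics", gen 8). Label: **RH-FREE**. THEOREMS only — NO definition, NO new named fact (D-0026).
Nothing here bears on the truth of RH.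

Each statement below is a tree theorem that took the two inputs of Brent–Platt–Trudgian's refined
Lehman lemma as hypotheses — the standing condition (2.9) on `[2π, ∞)`
(`BrentPlattTrudgian2021_eq29`: `|∫_{168π}^T S| ≤ 2.067 + 0.059 log T`) and Lemma 2
(`BrentPlattTrudgian2021_lemma2`: `|Q − S| ≤ 1/(150t)`) — with BOTH now supplied by theorems:
`BrentPlattTrudgian2021_eq29_holds` (`ZetaArgSIntegralLowHeightNumerics.lean`, gen 8: Trudgian 2011
Thm 2.2 beyond `168π` + the kernel computation on `[2π, 168π]`) and `BrentPlattTrudgian2021_lemma2_holds`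
(`RiemannSiegelStirlingThirdOrder.lean`, gen 7). Computational lane (the inputs rest on the tree's
`native_decide` certificates: the first `2000` zeros, Trudgian's numerics, the `2087`-cell test).

* `abs_integral_zetaArgS_le_of_two_pi_le` — `|∫_{t₁}^{t₂} S| ≤ 4.134 + 0.059(log t₁ + log t₂)` for
  `2π ≤ t₁ ≤ t₂` (a Turing-type bound available from height `2π`).
* `BrentPlattTrudgian2021_thm1_E2_printed` — **Theorem 1, eq. (1.3) with the printed constants for every
  `T₁ ≥ 2π`**: `|E₂(T₁)| = |∫_{T₁}^∞ φ'Q| ≤ 2(2.067 + 0.059 log T₁)|φ'(T₁)| + (0.059 + 1/150)φ(T₁)/T₁`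
  (`φ ≥ 0`, `φ' ≤ 0 ≤ φ''`, `∫φ/t < ∞`; the source has Trudgian 2014's `A₂ = 0.2` where the tree's
  Lemma 2 gives `1/150`).
* `BrentPlattTrudgian2021_lemma3_printed_unconditional` — Lemma 3 (3.2) on `[T₁, T₂]`, `2π ≤ T₁ ≤ T₂`.
* `BrentPlattTrudgian2021BAMS_lemma2_unconditional`, `BrentPlattTrudgian2021BAMS_thm2_unconditional` —
  **BAMS Lemma 2 and Theorem 2 as printed**: for all `T ≥ 2π`,
  `H = Σ_{0<γ≤T}(1/γ − 1/T) − (log²(T/2πe) + 1)/(4π) + 7/(8T) + E₂(T)`, `|E₂(T)| ≤ (4.27 + 0.12 log T)/T²`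
  (`H = zetaZeroHarmonicLimit`).
* `BrentPlattTrudgian2021_example1_E2_unconditional` — Example 1: `|2∫_T^∞ Q/t³| ≤ (8.334 + 0.236 log T)/T³`
  for all `T ≥ 2π`.

## References

* R. P. Brent, D. J. Platt, T. S. Trudgian, *The mean square of the error term in the prime number
  theorem*, Math. Comp. 90 (2021) 2923–2935, Thm 1 (1.3), Lemma 3 (3.2), §4 Example 1. [BrentPlattTrudgian2021]
* R. P. Brent, D. J. Platt, T. S. Trudgian, *A harmonic sum over nontrivial zeros of the Riemann
  zeta-function*, Bull. Aust. Math. Soc. 104 (2021) 59–65, Lemma 2, Thm 2. [BrentPlattTrudgian2021BAMS]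
* T. S. Trudgian, Math. Comp. 80 (2011) 2259–2279, Thm 2.2. [Trudgian2011]
-/

noncomputable section

open Complex Real Set Filter MeasureTheory intervalIntegral

namespace Literature.NumberTheory.LFunctions

open SchoenfeldBound

/-- **A Turing-type bound for `∫ S` from height `2π`**: for `2π ≤ t₁ ≤ t₂`,
`|∫_{t₁}^{t₂} S(t) dt| ≤ 4.134 + 0.059 (log t₁ + log t₂)` (both integrals from `168π` are bounded by
(2.9): `BrentPlattTrudgian2021_eq29_holds`). [cite: BrentPlattTrudgian2021, §2 eq. (2.9)]
[cite: Trudgian2011, Thm. 2.2] -/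
theorem abs_integral_zetaArgS_le_of_two_pi_le {t₁ t₂ : ℝ} (h1 : 2 * π ≤ t₁) (h12 : t₁ ≤ t₂) :
    |∫ t in t₁..t₂, zetaArgS t| ≤ 4.134 + 0.059 * (Real.log t₁ + Real.log t₂) := by
  have ha := BrentPlattTrudgian2021_eq29_holds t₁ h1
  have hb := BrentPlattTrudgian2021_eq29_holds t₂ (h1.trans h12)
  have hsplit : ∫ t in t₁..t₂, zetaArgS t =
      (∫ t in (168 * π)..t₂, zetaArgS t) - ∫ t in (168 * π)..t₁, zetaArgS t :=
    (intervalIntegral.integral_interval_sub_left (intervalIntegrable_zetaArgS _ _)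
      (intervalIntegrable_zetaArgS _ _)).symm
  rw [hsplit]
  have := abs_sub (∫ t in (168 * π)..t₂, zetaArgS t) (∫ t in (168 * π)..t₁, zetaArgS t)
  linarith

/-- **Brent–Platt–Trudgian 2021, Theorem 1 eq. (1.3) with the printed constants, UNCONDITIONAL for every
`T₁ ≥ 2π`**: for `φ ∈ C²[T₁,∞)` with `φ ≥ 0`, `φ' ≤ 0 ≤ φ''`, `∫_{T₁}^∞ φ/t < ∞`,
`|E₂(T₁)| = |∫_{T₁}^∞ φ'Q| ≤ 2(2.067 + 0.059 log T₁)|φ'(T₁)| + (0.059 + 1/150)φ(T₁)/T₁`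
(`A₀ = 2.067`, `A₁ = 0.059` by `BrentPlattTrudgian2021_eq29_holds`, base point `168π`; `A₂ = 1/150` by
`BrentPlattTrudgian2021_lemma2_holds`). [cite: BrentPlattTrudgian2021, Theorem 1 eq. (1.3)] -/
theorem BrentPlattTrudgian2021_thm1_E2_printed {T₁ : ℝ} (h1 : 2 * π ≤ T₁) {φ φ' φ'' : ℝ → ℝ}
    (hφ : ∀ t ∈ Ici T₁, HasDerivAt φ (φ' t) t) (hφ' : ∀ t ∈ Ici T₁, HasDerivAt φ' (φ'' t) t)
    (hφ'' : ContinuousOn φ'' (Ici T₁)) (hφ0 : ∀ t ∈ Ici T₁, 0 ≤ φ t)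
    (hφ'0 : ∀ t ∈ Ici T₁, φ' t ≤ 0) (hφ''0 : ∀ t ∈ Ici T₁, 0 ≤ φ'' t)
    (hint : IntegrableOn (fun t ↦ φ t / t) (Ioi T₁)) :
    |∫ t in Ioi T₁, ((zetaZeroCount t : ℝ) - countMain t) * φ' t| ≤
      2 * (2.067 + 0.059 * Real.log T₁) * |φ' T₁| + (0.059 + 1 / 150) * φ T₁ / T₁ := by
  have hπ : 3 < π := Real.pi_gt_three
  have h3 : (3 : ℝ) ≤ T₁ := by linarith
  have hS1 : ∀ t ∈ Ici T₁, |∫ x in (168 * π)..t, zetaArgS x| ≤ 2.067 + 0.059 * Real.log t :=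
    fun t ht ↦ BrentPlattTrudgian2021_eq29_holds t (h1.trans ht)
  have hQS : ∀ t ∈ Ici T₁, |((zetaZeroCount t : ℝ) - countMain t) - zetaArgS t| ≤ (1 / 150) / t := by
    intro t ht
    have h := BrentPlattTrudgian2021_lemma2_holds t (h1.trans ht)
    rwa [div_div]
  exact BrentPlattTrudgian2021_thm1_E2 h3 (by norm_num) hφ hφ' hφ'' hφ0 hφ'0 hφ''0 hint hS1 hQS

/-- **Brent–Platt–Trudgian 2021, Lemma 3 (3.2) with the printed constants, UNCONDITIONAL**: for
`2π ≤ T₁ ≤ T₂`, `φ ∈ C²[T₁,T₂]` with `φ' ≤ 0 ≤ φ''`, `φ(T₂) ≥ 0`,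
`|Σ_{T₁<γ≤T₂} m(ρ)φ(γ) − (1/2π)∫φ log(t/2π) − (φ(T₂)Q(T₂) − φ(T₁)Q(T₁))|
  ≤ 2(2.067 + 0.059 log T₁)|φ'(T₁)| + (0.059 + 1/150)φ(T₁)/T₁`.
[cite: BrentPlattTrudgian2021, Lemma 3 (3.2)] -/
theorem BrentPlattTrudgian2021_lemma3_printed_unconditional {T₁ T₂ : ℝ} (h1 : 2 * π ≤ T₁) (h12 : T₁ ≤ T₂)
    {φ φ' φ'' : ℝ → ℝ}
    (hφ : ∀ t ∈ Icc T₁ T₂, HasDerivAt φ (φ' t) t) (hφ' : ∀ t ∈ Icc T₁ T₂, HasDerivAt φ' (φ'' t) t)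
    (hφ'' : ContinuousOn φ'' (Icc T₁ T₂)) (hφ'0 : ∀ t ∈ Icc T₁ T₂, φ' t ≤ 0)
    (hφ''0 : ∀ t ∈ Icc T₁ T₂, 0 ≤ φ'' t) (hφT : 0 ≤ φ T₂) :
    |∑ ρ ∈ zerosBetween T₁ T₂, (riemannZetaZeroOrder ρ : ℝ) * φ ρ.im
        - (∫ t in T₁..T₂, φ t * Real.log (t / (2 * π))) / (2 * π)
        - (((zetaZeroCount T₂ : ℝ) - countMain T₂) * φ T₂
            - ((zetaZeroCount T₁ : ℝ) - countMain T₁) * φ T₁)| ≤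
      2 * (2.067 + 0.059 * Real.log T₁) * |φ' T₁| + (0.059 + 1 / 150) * φ T₁ / T₁ :=
  BrentPlattTrudgian2021_lemma3_printed' BrentPlattTrudgian2021_eq29_holds h1 h12 hφ hφ' hφ'' hφ'0
    hφ''0 hφT

/-- **Brent–Platt–Trudgian 2021 (BAMS), Lemma 2, UNCONDITIONAL**: for every `T ≥ 2π`,
`|E₂(T)| = |∫_T^∞ Q/t²| ≤ (4.27 + 0.12 log T)/T²`. [cite: BrentPlattTrudgian2021BAMS, Lemma 2] -/
theorem BrentPlattTrudgian2021BAMS_lemma2_unconditional {T : ℝ} (hT : 2 * π ≤ T) :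
    |∫ t in Ioi T, ((zetaZeroCount t : ℝ) - countMain t) / t ^ 2| ≤
      (4.27 + 0.12 * Real.log T) / T ^ 2 :=
  BrentPlattTrudgian2021BAMS_lemma2' BrentPlattTrudgian2021_eq29_holds hT

/-- **Brent–Platt–Trudgian 2021 (BAMS), Theorem 2, AS PRINTED and UNCONDITIONAL**: "For all `T ≥ 2π`,
`H = Σ_{0<γ≤T} (1/γ − 1/T) − (log²(T/2πe) + 1)/(4π) + 7/(8T) + E₂(T)`, where
`|E₂(T)| ≤ (4.27 + 0.12 log T)/T²`" (`H = zetaZeroHarmonicLimit`).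
[cite: BrentPlattTrudgian2021BAMS, Theorem 2] -/
theorem BrentPlattTrudgian2021BAMS_thm2_unconditional {T : ℝ} (hT : 2 * π ≤ T) :
    |zetaZeroHarmonicLimit
        - (∑ ρ ∈ zerosBetween 0 T, (riemannZetaZeroOrder ρ : ℝ) * (1 / ρ.im - 1 / T)
          - (Real.log (T / (2 * π * Real.exp 1)) ^ 2 + 1) / (4 * π) + 7 / (8 * T))| ≤
      (4.27 + 0.12 * Real.log T) / T ^ 2 :=
  BrentPlattTrudgian2021BAMS_thm2' BrentPlattTrudgian2021_eq29_holds hT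

/-- **Brent–Platt–Trudgian 2021, §4 Example 1, the printed error, UNCONDITIONAL**: for every
`T ≥ 2π`, `|2∫_T^∞ Q/t³| ≤ (8.334 + 0.236 log T)/T³` (so, with `zetaZeroInvSqLimit_tendsto`,
`c₁ = Σ_{0<γ≤T}(1/γ² − 1/T²) − log²(T/2π)/(4πT²)·… ` as in the tree's `BrentPlattTrudgian2021_example1_tendsto`).
[cite: BrentPlattTrudgian2021, §4 Example 1] -/
theorem BrentPlattTrudgian2021_example1_E2_unconditional {T : ℝ} (hT : 2 * π ≤ T) :
    |2 * ∫ t in Ioi T, ((zetaZeroCount t : ℝ) - countMain t) / t ^ 3| ≤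
      (8.334 + 0.236 * Real.log T) / T ^ 3 :=
  BrentPlattTrudgian2021_example1_E2' BrentPlattTrudgian2021_eq29_holds hT

end Literature.NumberTheory.LFunctions
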